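import Summits.NavierStokesRegularity.NavierStokesRegularity.Theorems.SqueezeCycleSingularZoomWindow
import Summits.NavierStokesRegularity.NavierStokesRegularity.Theorems.SqueezeCycleExtremalElementExistsExtraction
import HarnessLib

/-!
# `C¹_loc` compactness of Type-I Oseen-mild fields on growing final windows
# (route `SqueezeCycle`, item `SingularZoom`, stmt-NavierStokesRegularity-10573)

Helper file for the singular Type-I zoom. A sequence `w k` of fields which are jointly continuous
on `(A k, 0) × ℝ³`, have weakly divergence-free slices there, satisfy the Oseen integral equation
between all `A k < s < t < 0` and obey a common Type-I bound `‖w k t x‖ ≤ C/√(-t)` on `(A k, 0)`,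
where `A k → -∞`, has a subsequence converging together with its spatial gradients at every
point of the open slab `(-∞, 0) × ℝ³` — slice-wise even locally uniformly — to a Type-I ancient
mild field `W` of the Oseen gauge with the same constant (`IsTypeIAncientMild C W`)
(`exists_tendsto_of_typeI_seq_Ioo`). This is the tree's
`exists_tendsto_of_isTypeIAncientMild_seq` (ancient fields) with the window-local uniform bounds
of `SqueezeCycleSingularZoomWindow` (KNSS 2009, Prop. 4.1, (4.10)–(4.11)) in place of the
class-uniform ones: on each compact slab piece the pairs `(w k, ∇w k)` are bounded and uniformly
Lipschitz for all large `k`, a diagonal Arzelà–Ascoli extraction gives the limit pair, uniform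
limits of gradients are gradients, and the Type-I bound, weak divergence-freeness and the Oseen
equation pass to the limit by dominated convergence (KNSS 2009, Lemma 6.1).
-/

noncomputable section

open MeasureTheory Set Function Filter TopologicalSpace Metric
open scoped Topology NNReal ENNReal InnerProductSpace RealInnerProductSpace

namespace Summit.NavierStokesRegularity.NavierStokesRegularity.Theorems

open Literature.Analysis Literature.Analysis.FluidPDE

section Shift

variable {X Y : Type*} [UniformSpace Y]

/-- Uniform convergence along `atTop` is preserved by an index shift `j ↦ j + j₀`. [folklore] -/
theorem tendstoUniformlyOn_shift {F : ℕ → X → Y} {f : X → Y} {s : Set X}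
    (h : TendstoUniformlyOn F f atTop s) (j₀ : ℕ) :
    TendstoUniformlyOn (fun j => F (j + j₀)) f atTop s :=
  fun u hu => (tendsto_add_atTop_nat j₀).eventually (h u hu)

end Shift

section Compactness

/-- **`C¹_loc` compactness of Type-I Oseen-mild fields on growing final windows.** Let `w k` be
jointly continuous on `(A k, 0) × ℝ³` with weakly divergence-free slices, satisfy the Oseen
integral equation `w k t = e^{(t−s)Δ} w k s − B¹_s(w k, w k)(t)` for all `A k < s < t < 0`, and
obey `‖w k t x‖ ≤ C/√(−t)` for `A k < t < 0`, where `A k → −∞`. Then along some subsequence `φ`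
the fields and their spatial gradients converge at every point of the open slab `(-∞, 0) × ℝ³` —
the slices even locally uniformly — to a Type-I ancient mild field `W` of the Oseen gauge with
constant `C` and to its gradient. [cite: KochNadirashviliSereginSverak2009, Lemma 6.1 and Prop. 4.1 (arXiv:0709.3599 pp. 8, 11)] -/
theorem exists_tendsto_of_typeI_seq_Ioo (C : ℝ) {A : ℕ → ℝ} (hA : Tendsto A atTop atBot)
    {w : ℕ → ℝ → EuclideanSpace ℝ (Fin 3) → EuclideanSpace ℝ (Fin 3)}
    (hc : ∀ k, ContinuousOn (uncurry (w k)) (Ioo (A k) 0 ×ˢ univ))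
    (hdivw : ∀ k, ∀ t ∈ Ioo (A k) 0, IsWeaklyDivFree (w k t))
    (hmild : ∀ k, ∀ s t : ℝ, A k < s → s < t → t < 0 → ∀ x,
      w k t x = UnboundedOperators.heatExtension (w k s) (t - s) x - oseenDuhamel 1 s (w k) (w k) t x)
    (hI : ∀ k, ∀ t ∈ Ioo (A k) 0, ∀ x, ‖w k t x‖ ≤ C / Real.sqrt (-t)) :
    ∃ φ : ℕ → ℕ, StrictMono φ ∧
      ∃ W : ℝ → EuclideanSpace ℝ (Fin 3) → EuclideanSpace ℝ (Fin 3), IsTypeIAncientMild C W ∧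
        (∀ t < 0, ∀ x, Tendsto (fun j => w (φ j) t x) atTop (𝓝 (W t x))) ∧
        (∀ t < 0, ∀ x, Tendsto (fun j => fderiv ℝ (w (φ j) t) x) atTop (𝓝 (fderiv ℝ (W t) x))) ∧
        (∀ t < 0, TendstoLocallyUniformly (fun j => w (φ j) t) (W t) atTop) ∧
        (∀ t < 0, TendstoLocallyUniformly (fun j => fderiv ℝ (w (φ j) t)) (fderiv ℝ (W t)) atTop) := by
  -- ## Step 0: per-`k` facts on `(A k, 0)`
  have hsm : ∀ k, ContDiffOn ℝ (⊤ : ℕ∞) (uncurry (w k)) (Ioo (A k) 0 ×ˢ univ) := fun k =>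
    contDiffOn_of_Ioo (hc k) (hdivw k) (hmild k) (hI k)
  have hDc : ∀ k, ContinuousOn (fun z : ℝ × EuclideanSpace ℝ (Fin 3) => fderiv ℝ (w k z.1) z.2)
      (Ioo (A k) 0 ×ˢ univ) := fun k =>
    IsSmoothSpaceTimeOn.continuousOn_fderiv_slice (S := Ioo (A k) 0) (w := w k) (hsm k)
      isOpen_Ioo.uniqueDiffOn
  have hsmooth : ∀ k, ∀ t ∈ Ioo (A k) 0, ContDiff ℝ ((⊤ : ℕ∞) : WithTop ℕ∞) (w k t) :=
    fun k t ht => (hsm k).comp_contDiff (contDiff_prodMk_right t) fun x => ⟨ht, mem_univ x⟩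
  have hdiff : ∀ k, ∀ t ∈ Ioo (A k) 0, Differentiable ℝ (w k t) := fun k t ht =>
    (hsmooth k t ht).differentiable (by simp)
  have hdiff2 : ∀ k, ∀ t ∈ Ioo (A k) 0, Differentiable ℝ (fderiv ℝ (w k t)) := fun k t ht =>
    ((hsmooth k t ht).fderiv_right (m := 1) (by norm_cast)).differentiable (by simp)
  have hslice : ∀ k, ∀ t ∈ Ioo (A k) 0, Continuous (w k t) := fun k t ht =>
    (hc k).comp_continuous (Continuous.prodMk_right t) fun x => ⟨ht, mem_univ x⟩
  -- `0 ≤ C` (some window is nonempty)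
  have hC : 0 ≤ C := by
    obtain ⟨k, hk⟩ := (hA.eventually (eventually_lt_atBot (-1 : ℝ))).exists
    exact typeI_const_nonneg_of_norm_le (u := w k) (by norm_num) 0
      (hI k (-1) ⟨hk, by norm_num⟩ 0)
  -- ## Step 1: windows and window-uniform constants on the pieces
  set a : ℕ → ℝ := fun n => -((n : ℝ) + 3) with ha
  set b : ℕ → ℝ := fun n => -(1 / (2 * ((n : ℝ) + 2))) with hb
  have hab : ∀ n, a n < b n := fun n => by
    have : (0 : ℝ) < 1 / (2 * ((n : ℝ) + 2)) := by positivity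
    have h2 : 1 / (2 * ((n : ℝ) + 2)) ≤ 1 := by
      rw [div_le_one (by positivity)]; linarith [(Nat.cast_nonneg n : (0 : ℝ) ≤ n)]
    simp only [ha, hb]; linarith [(Nat.cast_nonneg n : (0 : ℝ) ≤ n)]
  have hb0 : ∀ n, b n < 0 := fun n => by
    have : (0 : ℝ) < 1 / (2 * ((n : ℝ) + 2)) := by positivity
    simp only [hb]; linarith
  have hab1 : ∀ n, a n + 1 < b n := fun n => by
    have h2 : 1 / (2 * ((n : ℝ) + 2)) ≤ 1 := by
      rw [div_le_one (by positivity)]; linarith [(Nat.cast_nonneg n : (0 : ℝ) ≤ n)]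
    simp only [ha, hb]; linarith [(Nat.cast_nonneg n : (0 : ℝ) ≤ n)]
  -- eventually the window `(a n, b n)` lies inside `(A k, 0)`
  have hAa : ∀ n, ∀ᶠ k in atTop, A k < a n := fun n => hA.eventually (eventually_lt_atBot (a n))
  -- the slab pieces
  set T : ℕ → Set (ℝ × EuclideanSpace ℝ (Fin 3)) := fun n =>
    Icc (-((n : ℝ) + 2)) (-(1 / ((n : ℝ) + 2))) ×ˢ closedBall (0 : EuclideanSpace ℝ (Fin 3)) ((n : ℝ) + 2)
    with hT
  have hTwin : ∀ n, ∀ z ∈ T n, z.1 ∈ Ico (a n + 1) (b n) := fun n z hz => by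
    obtain ⟨⟨h1, h2⟩, -⟩ := mem_slabPiece.1 hz
    have hn2 : (0 : ℝ) < (n : ℝ) + 2 := by positivity
    refine ⟨by simp only [ha]; linarith, lt_of_le_of_lt h2 ?_⟩
    simp only [hb]
    rw [neg_lt_neg_iff, div_lt_div_iff_of_pos_left one_pos (by positivity) hn2]
    linarith
  have hTneg : ∀ n, ∀ z ∈ T n, z.1 < 0 := fun n z hz => ((hTwin n z hz).2).trans (hb0 n)
  have hTA : ∀ n k, A k < a n → ∀ z ∈ T n, z.1 ∈ Ioo (A k) 0 := fun n k hk z hz =>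
    ⟨by linarith [(hTwin n z hz).1], hTneg n z hz⟩
  -- constants
  have e0 := fun n : ℕ => exists_norm_iteratedFDeriv_le_of_typeI_Ioo C 0 (hab n) (hb0 n) one_pos
  have e1 := fun n : ℕ => exists_norm_iteratedFDeriv_le_of_typeI_Ioo C 1 (hab n) (hb0 n) one_pos
  have e2 := fun n : ℕ => exists_norm_iteratedFDeriv_le_of_typeI_Ioo C 2 (hab n) (hb0 n) one_pos
  have l0 := fun n : ℕ => exists_lipschitz_time_of_typeI_Ioo C 0 (hab n) (hb0 n) one_pos
  have l1 := fun n : ℕ => exists_lipschitz_time_of_typeI_Ioo C 1 (hab n) (hb0 n) one_pos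
  choose K0 hK0 using e0
  choose K1 hK1 using e1
  choose K2 hK2 using e2
  choose L0 hL00 hL0 using l0
  choose L1 hL10 hL1 using l1
  -- pointwise bounds on the pieces, for every `k` with `A k < a n`
  have hB0 : ∀ n k, A k < a n → ∀ z ∈ T n, ‖w k z.1 z.2‖ ≤ K0 n := fun n k hk z hz => by
    have h := hK0 n hk (hc k) (hdivw k) (hmild k) (hI k) z.1 (hTwin n z hz) z.2
    rwa [norm_iteratedFDeriv_zero] at h
  have hB1 : ∀ n k, A k < a n → ∀ t ∈ Ico (a n + 1) (b n), ∀ x, ‖fderiv ℝ (w k t) x‖ ≤ K1 n :=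
    fun n k hk t ht x => by
    have h := hK1 n hk (hc k) (hdivw k) (hmild k) (hI k) t ht x
    rwa [norm_iteratedFDeriv_one] at h
  have hB2 : ∀ n k, A k < a n → ∀ t ∈ Ico (a n + 1) (b n), ∀ x,
      ‖fderiv ℝ (fderiv ℝ (w k t)) x‖ ≤ K2 n := fun n k hk t ht x => by
    have h := hK2 n hk (hc k) (hdivw k) (hmild k) (hI k) t ht x
    rwa [← FunctionSpaces.norm_fderiv_fderiv_eq_norm_iteratedFDeriv_two] at h
  have hK1nn : ∀ n, 0 ≤ K1 n := fun n => by
    obtain ⟨k, hk⟩ := (hAa n).exists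
    exact (norm_nonneg _).trans (hB1 n k hk (a n + 1) ⟨le_rfl, hab1 n⟩ 0)
  have hK2nn : ∀ n, 0 ≤ K2 n := fun n => by
    obtain ⟨k, hk⟩ := (hAa n).exists
    exact (norm_nonneg (fderiv ℝ (fderiv ℝ (w k (a n + 1))) 0)).trans
      (hB2 n k hk (a n + 1) ⟨le_rfl, hab1 n⟩ 0)
  -- ## Step 2: the pair maps and their moduli on the pieces (for all large `k`)
  set V : ℕ → ℝ × EuclideanSpace ℝ (Fin 3) →
      EuclideanSpace ℝ (Fin 3) × (EuclideanSpace ℝ (Fin 3) →L[ℝ] EuclideanSpace ℝ (Fin 3)) :=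
    fun k z => (w k z.1 z.2, fderiv ℝ (w k z.1) z.2) with hV
  have hVn : ∀ n : ℕ, ∀ᶠ k in atTop, ContinuousOn (V k) (T n) ∧
      (∀ z ∈ T n, ‖V k z‖ ≤ max (K0 n) (K1 n)) ∧
      ∀ z ∈ T n, ∀ z' ∈ T n,
        dist (V k z) (V k z') ≤ (K1 n + L0 n + (K2 n + L1 n)) * dist z z' ^ (1 : ℝ) := by
    intro n
    filter_upwards [hAa n] with k hk
    refine ⟨?_, fun z hz => ?_, fun z hz z' hz' => ?_⟩
    · have hsub : T n ⊆ Ioo (A k) 0 ×ˢ univ := fun z hz => ⟨hTA n k hk z hz, mem_univ _⟩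
      exact ((hc k).mono hsub).prodMk ((hDc k).mono hsub)
    · rw [hV, Prod.norm_mk]
      exact max_le_max (hB0 n k hk z hz) (hB1 n k hk z.1 (hTwin n z hz) z.2)
    · rw [Real.rpow_one]
      have ht := hTwin n z hz
      have ht' := hTwin n z' hz'
      have hzA := hTA n k hk z hz
      have hdt : |z.1 - z'.1| ≤ dist z z' := by
        rw [← Real.dist_eq, Prod.dist_eq]; exact le_max_left _ _
      have hdx : ‖z.2 - z'.2‖ ≤ dist z z' := by
        rw [← dist_eq_norm, Prod.dist_eq]; exact le_max_right _ _
      have hd0 : 0 ≤ dist z z' := dist_nonneg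
      -- values
      have hv1 : ‖w k z.1 z.2 - w k z.1 z'.2‖ ≤ K1 n * ‖z.2 - z'.2‖ :=
        (convex_univ.norm_image_sub_le_of_norm_fderiv_le (fun x _ => (hdiff k z.1 hzA) x)
          (fun x _ => hB1 n k hk z.1 ht x) (mem_univ z'.2) (mem_univ z.2))
      have hv2 : ‖w k z.1 z'.2 - w k z'.1 z'.2‖ ≤ L0 n * |z.1 - z'.1| := by
        have h := hL0 n hk (hc k) (hdivw k) (hmild k) (hI k) z'.1 ht' z.1 ht z'.2
        rwa [DerivInterp.norm_iteratedFDeriv_zero_sub] at h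
      have hval : ‖w k z.1 z.2 - w k z'.1 z'.2‖ ≤ (K1 n + L0 n) * dist z z' := by
        calc ‖w k z.1 z.2 - w k z'.1 z'.2‖
            ≤ ‖w k z.1 z.2 - w k z.1 z'.2‖ + ‖w k z.1 z'.2 - w k z'.1 z'.2‖ :=
              norm_sub_le_norm_sub_add_norm_sub _ _ _
          _ ≤ K1 n * dist z z' + L0 n * dist z z' := add_le_add
              (hv1.trans (mul_le_mul_of_nonneg_left hdx (hK1nn n)))
              (hv2.trans (mul_le_mul_of_nonneg_left hdt (hL00 n)))
          _ = (K1 n + L0 n) * dist z z' := by ring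
      -- gradients
      have hg1 : ‖fderiv ℝ (w k z.1) z.2 - fderiv ℝ (w k z.1) z'.2‖ ≤ K2 n * ‖z.2 - z'.2‖ :=
        (convex_univ.norm_image_sub_le_of_norm_fderiv_le
          (fun x _ => (hdiff2 k z.1 hzA) x)
          (fun x _ => hB2 n k hk z.1 ht x) (mem_univ z'.2) (mem_univ z.2))
      have hg2 : ‖fderiv ℝ (w k z.1) z'.2 - fderiv ℝ (w k z'.1) z'.2‖ ≤ L1 n * |z.1 - z'.1| := by
        have h := hL1 n hk (hc k) (hdivw k) (hmild k) (hI k) z'.1 ht' z.1 ht z'.2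
        rwa [norm_iteratedFDeriv_one_sub] at h
      have hgrad : ‖fderiv ℝ (w k z.1) z.2 - fderiv ℝ (w k z'.1) z'.2‖ ≤
          (K2 n + L1 n) * dist z z' := by
        calc ‖fderiv ℝ (w k z.1) z.2 - fderiv ℝ (w k z'.1) z'.2‖
            ≤ ‖fderiv ℝ (w k z.1) z.2 - fderiv ℝ (w k z.1) z'.2‖ +
                ‖fderiv ℝ (w k z.1) z'.2 - fderiv ℝ (w k z'.1) z'.2‖ :=
              norm_sub_le_norm_sub_add_norm_sub _ _ _
          _ ≤ K2 n * dist z z' + L1 n * dist z z' := add_le_add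
              (hg1.trans (mul_le_mul_of_nonneg_left hdx (hK2nn n)))
              (hg2.trans (mul_le_mul_of_nonneg_left hdt (hL10 n)))
          _ = (K2 n + L1 n) * dist z z' := by ring
      rw [hV, dist_eq_norm, Prod.mk_sub_mk, Prod.norm_mk]
      refine max_le (hval.trans ?_) (hgrad.trans ?_)
      · exact mul_le_mul_of_nonneg_right (by linarith [hK2nn n, hL10 n]) hd0
      · exact mul_le_mul_of_nonneg_right (by linarith [hK1nn n, hL00 n]) hd0
  -- ## Step 3: extraction
  obtain ⟨φ, hφ, P, hP⟩ := exists_strictMono_tendstoUniformlyOn_of_bound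
    (fun n => isCompact_slabPiece (E := EuclideanSpace ℝ (Fin 3)) n)
    (fun n => by linarith [hK1nn n, hL00 n, hK2nn n, hL10 n]) (fun _ => one_pos) hVn
  set W : ℝ → EuclideanSpace ℝ (Fin 3) → EuclideanSpace ℝ (Fin 3) := fun t x => (P (t, x)).1 with hWdef
  set G : ℝ → EuclideanSpace ℝ (Fin 3) → (EuclideanSpace ℝ (Fin 3) →L[ℝ] EuclideanSpace ℝ (Fin 3)) :=
    fun t x => (P (t, x)).2 with hGdef
  have hW0 : ∀ n, TendstoUniformlyOn (fun j z => w (φ j) z.1 z.2) (fun z => W z.1 z.2) atTop (T n) :=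
    fun n => by
    have h := uniformContinuous_fst.comp_tendstoUniformlyOn (hP n)
    exact (h.congr (Eventually.of_forall fun j => fun z _ => rfl)).congr_right fun z _ => rfl
  have hG0 : ∀ n, TendstoUniformlyOn (fun j z => fderiv ℝ (w (φ j) z.1) z.2) (fun z => G z.1 z.2) atTop
      (T n) := fun n => by
    have h := uniformContinuous_snd.comp_tendstoUniformlyOn (hP n)
    exact (h.congr (Eventually.of_forall fun j => fun z _ => rfl)).congr_right fun z _ => rfl
  have hφt : Tendsto φ atTop atTop := hφ.tendsto_atTop
  have hAφ : Tendsto (fun j => A (φ j)) atTop atBot := hA.comp hφt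
  -- eventually (in `j`) the level `s` is inside the window of `w (φ j)`
  have hlev : ∀ s : ℝ, ∃ j₀ : ℕ, ∀ j, j₀ ≤ j → A (φ j) < s := fun s =>
    eventually_atTop.1 (hAφ.eventually (eventually_lt_atBot s))
  -- continuity of the limit on the open slab
  have hWc : ContinuousOn (uncurry W) (Iio 0 ×ˢ univ) := by
    have hVφ : ∀ n, ∀ᶠ j in atTop, ContinuousOn (fun z : ℝ × EuclideanSpace ℝ (Fin 3) => w (φ j) z.1 z.2)
        (T n) := fun n => by
      filter_upwards [hφt.eventually (hAa n)] with j hj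
      exact (hc (φ j)).mono fun z hz => ⟨hTA n (φ j) hj z hz, mem_univ _⟩
    exact (continuousOn_slab_of_tendstoUniformlyOn hVφ hW0).congr fun z _ => rfl
  -- pointwise convergence of values and gradients
  have hpt : ∀ t < 0, ∀ x, Tendsto (fun j => w (φ j) t x) atTop (𝓝 (W t x)) := fun t ht x =>
    tendsto_of_tendstoUniformlyOn_slabPiece hW0 ht x
  have hptG : ∀ t < 0, ∀ x, Tendsto (fun j => fderiv ℝ (w (φ j) t) x) atTop (𝓝 (G t x)) :=
    fun t ht x => tendsto_of_tendstoUniformlyOn_slabPiece hG0 ht x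
  -- slice-wise locally uniform convergence
  have hlu : ∀ t < 0, TendstoLocallyUniformly (fun j => w (φ j) t) (W t) atTop := fun t ht =>
    tendstoLocallyUniformly_slice_of_tendstoUniformlyOn_slabPiece hW0 ht
  have hluG : ∀ t < 0, TendstoLocallyUniformly (fun j => fderiv ℝ (w (φ j) t)) (G t) atTop :=
    fun t ht => tendstoLocallyUniformly_slice_of_tendstoUniformlyOn_slabPiece hG0 ht
  -- the limit of the gradients is the gradient of the limit (shift past the window entrance)
  have hWD : ∀ t < 0, ∀ x, HasFDerivAt (W t) (G t x) x := by
    intro t ht x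
    obtain ⟨j₀, hj₀⟩ := hlev t
    have hG0' : ∀ n, TendstoUniformlyOn (fun j z => fderiv ℝ (w (φ (j + j₀)) z.1) z.2)
        (fun z => G z.1 z.2) atTop (T n) := fun n => tendstoUniformlyOn_shift (hG0 n) j₀
    have hluG' : TendstoLocallyUniformly (fun j => fderiv ℝ (w (φ (j + j₀)) t)) (G t) atTop :=
      tendstoLocallyUniformly_slice_of_tendstoUniformlyOn_slabPiece hG0' ht
    refine hasFDerivAt_of_tendstoLocallyUniformlyOn isOpen_univ hluG'.tendstoLocallyUniformlyOn
      (fun j y _ => ((hdiff (φ (j + j₀)) t ⟨hj₀ _ (Nat.le_add_left _ _), ht⟩) y).hasFDerivAt)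
      (fun y _ => (hpt t ht y).comp (tendsto_add_atTop_nat j₀)) (mem_univ x)
  have hWG : ∀ t < 0, ∀ x, fderiv ℝ (W t) x = G t x := fun t ht x => (hWD t ht x).fderiv
  -- ## Step 4a: weak divergence-freeness of the limit slices
  have hWdiv : ∀ t < 0, IsWeaklyDivFree (W t) := by
    intro t ht θ hθ
    obtain ⟨j₀, hj₀⟩ := hlev t
    have hev : ∀ᶠ j in atTop, A (φ j) < t := eventually_atTop.2 ⟨j₀, hj₀⟩
    have hθ1 : ContDiff ℝ 1 θ := contDiff_infty.1 hθ.contDiff 1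
    have hgc : HasCompactSupport (gradient θ) := by
      have : gradient θ = (fun L => (InnerProductSpace.toDual ℝ (EuclideanSpace ℝ (Fin 3))).symm L) ∘
          fderiv ℝ θ := rfl
      rw [this]
      exact (hθ.hasCompactSupport.fderiv (𝕜 := ℝ)).comp_left (by simp)
    set Mt : ℝ := C / Real.sqrt (-t) with hMt
    have hθi : Integrable (fun x => Mt * ‖gradient θ x‖) volume :=
      (((continuous_gradient_of_contDiff hθ1).integrable_of_hasCompactSupport hgc).norm).const_mul Mt
    have hlimθ : Tendsto (fun j => ∫ x, ⟪w (φ j) t x, gradient θ x⟫_ℝ) atTop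
        (𝓝 (∫ x, ⟪W t x, gradient θ x⟫_ℝ)) := by
      refine tendsto_integral_filter_of_dominated_convergence (fun x => Mt * ‖gradient θ x‖)
        ?_ ?_ hθi (Eventually.of_forall fun x => (hpt t ht x).inner tendsto_const_nhds)
      · filter_upwards [hev] with j hj
        exact ((hslice (φ j) t ⟨hj, ht⟩).inner (continuous_gradient_of_contDiff hθ1)).aestronglyMeasurable
      · filter_upwards [hev] with j hj
        exact Eventually.of_forall fun x =>
          (norm_inner_le_norm _ _).trans
            (mul_le_mul_of_nonneg_right (hI (φ j) t ⟨hj, ht⟩ x) (norm_nonneg _))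
    have hzero : ∀ᶠ j in atTop, (0 : ℝ) = ∫ x, ⟪w (φ j) t x, gradient θ x⟫_ℝ := by
      filter_upwards [hev] with j hj
      exact (hdivw (φ j) t ⟨hj, ht⟩ θ hθ).symm
    exact tendsto_nhds_unique hlimθ (tendsto_const_nhds.congr' hzero)
  -- ## Step 4b: the Type-I bound of the limit
  have hWI : HasTypeITimeDecay C W := by
    intro t ht x
    obtain ⟨j₀, hj₀⟩ := hlev t
    exact le_of_tendsto (hpt t ht x).norm
      (eventually_atTop.2 ⟨j₀, fun j hj => hI (φ j) t ⟨hj₀ j hj, ht⟩ x⟩)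
  -- ## Step 5: the Oseen identity in the limit (shift past the window entrance at level `s`)
  have hWmild : ∀ s t : ℝ, s < t → t < 0 → ∀ x,
      W t x = UnboundedOperators.heatExtension (W s) (t - s) x - oseenDuhamel 1 s W W t x := by
    intro s t hst ht x
    have hs0 : s < 0 := hst.trans ht
    obtain ⟨j₀, hj₀⟩ := hlev s
    set u : ℕ → ℝ → EuclideanSpace ℝ (Fin 3) → EuclideanSpace ℝ (Fin 3) := fun j => w (φ (j + j₀)) with hu
    have hAu : ∀ j, A (φ (j + j₀)) < s := fun j => hj₀ _ (Nat.le_add_left _ _)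
    have hptu : ∀ τ < 0, ∀ y, Tendsto (fun j => u j τ y) atTop (𝓝 (W τ y)) := fun τ hτ y =>
      (hpt τ hτ y).comp (tendsto_add_atTop_nat j₀)
    set M₀ : ℝ := C / Real.sqrt (-t) with hM₀
    have hM₀0 : 0 ≤ M₀ := by rw [hM₀]; positivity
    have huM : ∀ j, ∀ τ ∈ Ioo s t, ∀ y, ‖u j τ y‖ ≤ M₀ := fun j τ hτ y =>
      (hI _ τ ⟨(hAu j).trans hτ.1, hτ.2.trans ht⟩ y).trans
        (div_sqrt_neg_le hC (neg_pos.2 ht) (by linarith [hτ.2]))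
    have hum : ∀ j, AEStronglyMeasurable (uncurry (u j))
        ((volume : Measure (ℝ × EuclideanSpace ℝ (Fin 3))).restrict (Ioo s t ×ˢ univ)) := fun j =>
      ((hc _).mono (prod_mono (fun τ hτ => ⟨(hAu j).trans hτ.1, hτ.2.trans ht⟩) Subset.rfl)).aestronglyMeasurable
        (measurableSet_Ioo.prod MeasurableSet.univ)
    have hWm : AEStronglyMeasurable (uncurry W)
        ((volume : Measure (ℝ × EuclideanSpace ℝ (Fin 3))).restrict (Ioo s t ×ˢ univ)) :=
      (hWc.mono (prod_mono (fun τ hτ => hτ.2.trans ht) Subset.rfl)).aestronglyMeasurable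
        (measurableSet_Ioo.prod MeasurableSet.univ)
    have hD : Tendsto (fun j => oseenDuhamel 1 s (u j) (u j) t x) atTop (𝓝 (oseenDuhamel 1 s W W t x)) :=
      tendsto_oseenDuhamel_of_tendsto_of_bound one_pos hM₀0 hst hum hWm huM
        (fun τ hτ y => hptu τ (hτ.2.trans ht) y) x
    have hH : Tendsto (fun j => UnboundedOperators.heatExtension (u j s) (t - s) x) atTop
        (𝓝 (UnboundedOperators.heatExtension (W s) (t - s) x)) :=
      tendsto_heatExtension_of_tendsto_of_bound (M := C / Real.sqrt (-s))
        (fun j => (hslice _ s ⟨hAu j, hs0⟩).aestronglyMeasurable) (fun j z => hI _ s ⟨hAu j, hs0⟩ z)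
        (hptu s hs0) (sub_pos.2 hst) x
    have hid : (fun j => u j t x) = fun j =>
        UnboundedOperators.heatExtension (u j s) (t - s) x - oseenDuhamel 1 s (u j) (u j) t x :=
      funext fun j => hmild _ s t (hAu j) hst ht x
    have hlim2 : Tendsto (fun j => u j t x) atTop
        (𝓝 (UnboundedOperators.heatExtension (W s) (t - s) x - oseenDuhamel 1 s W W t x)) := by
      rw [hid]; exact hH.sub hD
    exact tendsto_nhds_unique (hptu t ht x) hlim2
  -- ## Conclusion
  have hWclass : IsTypeIAncientMild C W := isTypeIAncientMild_of_continuous_oseenMild hWc hWdiv hWmild hWI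
  refine ⟨φ, hφ, W, hWclass, hpt, fun t ht x => ?_, hlu, fun t ht => ?_⟩
  · rw [hWG t ht x]; exact hptG t ht x
  · have e : fderiv ℝ (W t) = G t := funext fun x => hWG t ht x
    rw [e]; exact hluG t ht

end Compactness

end Summit.NavierStokesRegularity.NavierStokesRegularity.Theorems

end
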